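import Mathlib
import Literature.NumberTheory.LFunctions.Zhang2022.Section17U021ChiR1Assembly
import HarnessLib

/-!
# Zhang (2022) §17.u021 (χ-reading), remainder `R₁`: the FOUR-PIECE assembly of record
# (`hS` · `hLc` relative · `hLpB` bulk · `hLpW` window ⇒ «R1Rel c′»)

Topic `Literature/NumberTheory/LFunctions/Zhang2022` (Landau–Siegel audit tree; verdict-neutral).
Y. Zhang, *Discrete mean estimates and the Landau–Siegel zero*, arXiv:2211.02515v1 (2022)
[Zhang2022LandauSiegel] — **an unrefereed manuscript under adjudication; nothing here asserts or denies
its Theorems 1–2, and no claim about Landau–Siegel zeros is made.** Lane ZHANG-L, WP16, leaf h17_9,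
sub-leaf `R₁` of `Typed.Section17.Step17_u021Chi` («R1Rel c′»). §17 p. 98, tex L4825.

Companion of `Section17U021ChiR1Assembly` (p488502: the three-piece skeleton
`Phi3Eval.step17_u021Chi_R1Rel_of_split`). Rulings W16-S5h/W16-S5i (ZHANG-L, 2026-08-27) cut the
large-prime piece `hLp` at the seam `4·D⁴·p ≤ T²` (BULK, termwise, `≤ ε` under (A) — zl-w16-p3's final
statement text) / `T² < 4·D⁴·p` (WINDOW, termwise, `≤ ε(𝔞+1)` under (A) — zl-closer-1's final
statement text), and made the large-composite piece `hLc` RELATIVE (`≤ ε(𝔞+1)` under (A) — zl-w14-p2).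
This file is that FOUR-PIECE variant: `step17_u021Chi_R1Rel_of_split4abs (c′) (hS) (hLc) (hLpB) (hLpW)
: «R1Rel c′»` (the hypothesis `hR₁` of `step17_u024ChiRelE_of_R1Rel`, VERBATIM), each hypothesis
spelled inline in the hands' texts. Proof = the finite-support / triangle-inequality skeleton of the
three-piece file with a four-way pointwise range split (`norm_R1_summand_le_split4abs`; for prime `m₂`,
`(m₂, q₁) = 1 ↔ m₂ ∤ q₁`). Kernel service: zl-w16-plan g2 (`ScratchSplit4abs.lean`, farm rc 0); filed by
the R₁ owner. `hS` is already a theorem (`Phi3Eval.R1_small_holds`, `Section17U021ChiR1Small`).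

PROVED (theorems only): `norm_R1_summand_le_split4abs`, `step17_u021Chi_R1Rel_of_split4abs`.
WHAT THIS IS NOT: a proof of `hLc`, `hLpB`, `hLpW`.

## References

* Y. Zhang, arXiv:2211.02515v1 (2022), §17 p. 98 (u020–u021), tex L4821–L4827.
  [cite: Zhang2022LandauSiegel, §17 u021 p.98]
-/

noncomputable section

open Complex Real Finset
open Literature.NumberTheory.LFunctions.Zhang2022.Skeleton
open Literature.NumberTheory.LFunctions.Zhang2022.Typed.Section17

namespace Literature.NumberTheory.LFunctions.Zhang2022.Phi3Eval

/-- A double series whose terms vanish once either index is `≥ N` is the finite double sum over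
`range N × range N`. [folklore] -/
private theorem tsum_tsum_eq_sum_sum_of_vanish₅ {E : Type*} [NormedAddCommGroup E] [NormedSpace ℝ E]
    [CompleteSpace E] (F : ℕ → ℕ → E) (N : ℕ)
    (h₁ : ∀ m₁ m₂, N ≤ m₁ → F m₁ m₂ = 0) (h₂ : ∀ m₁ m₂, N ≤ m₂ → F m₁ m₂ = 0) :
    (∑' m₁ : ℕ, ∑' m₂ : ℕ, F m₁ m₂) = ∑ m₁ ∈ Finset.range N, ∑ m₂ ∈ Finset.range N, F m₁ m₂ := by
  have hin : ∀ m₁, (∑' m₂ : ℕ, F m₁ m₂) = ∑ m₂ ∈ Finset.range N, F m₁ m₂ := by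
    intro m₁
    refine tsum_eq_sum fun m₂ hm₂ => h₂ m₁ m₂ ?_
    simpa using hm₂
  rw [tsum_congr hin]
  refine tsum_eq_sum fun m₁ hm₁ => ?_
  have hN : N ≤ m₁ := by simpa using hm₁
  exact Finset.sum_eq_zero fun m₂ _ => h₁ m₁ m₂ hN

/-- **Pointwise four-way split**: the norm of the `R₁`-summand is at most the small + large-composite +
large-prime-BULK (zl-w16-p3 spelling) + large-prime-WINDOW (zl-closer-1 spelling) majorants.
[cite: Zhang2022LandauSiegel, §17 u021 p.98] -/
theorem norm_R1_summand_le_split4abs {T : ℂ} {W X Y : ℝ} (hW0 : 0 ≤ W) (hTW : ‖T‖ ≤ W)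
    (q₁ q₂ m₂ : ℕ) :
    ‖(if 2 ≤ m₂ ∧ Nat.Coprime m₂ q₁ then T else 0)‖ ≤
      (if (2 ≤ m₂ ∧ Nat.Coprime m₂ q₁) ∧ (q₂ : ℝ) * m₂ ≤ X then W else 0) +
      (if X < (q₂ : ℝ) * m₂ ∧ 2 ≤ m₂ ∧ ¬ m₂.Prime ∧ Nat.Coprime m₂ q₁ then W else 0) +
      (if X < (q₂ : ℝ) * m₂ ∧ m₂.Prime ∧ ¬ m₂ ∣ q₁ ∧ 4 * X * m₂ ≤ Y then W else 0) +
      (if (X < (q₂ : ℝ) * m₂ ∧ m₂.Prime ∧ Nat.Coprime m₂ q₁) ∧ Y < 4 * X * m₂ then W else 0) := by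
  have h1 : 0 ≤ (if (2 ≤ m₂ ∧ Nat.Coprime m₂ q₁) ∧ (q₂ : ℝ) * m₂ ≤ X then W else 0) := by
    split_ifs <;> simp [hW0]
  have h2 : 0 ≤ (if X < (q₂ : ℝ) * m₂ ∧ 2 ≤ m₂ ∧ ¬ m₂.Prime ∧ Nat.Coprime m₂ q₁ then W else 0) := by
    split_ifs <;> simp [hW0]
  have h3 : 0 ≤ (if X < (q₂ : ℝ) * m₂ ∧ m₂.Prime ∧ ¬ m₂ ∣ q₁ ∧ 4 * X * m₂ ≤ Y then W else 0) := by
    split_ifs <;> simp [hW0]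
  have h4 : 0 ≤ (if (X < (q₂ : ℝ) * m₂ ∧ m₂.Prime ∧ Nat.Coprime m₂ q₁) ∧ Y < 4 * X * m₂ then W
      else 0) := by
    split_ifs <;> simp [hW0]
  by_cases hP : 2 ≤ m₂ ∧ Nat.Coprime m₂ q₁
  · rw [if_pos hP]
    rcases le_or_gt ((q₂ : ℝ) * m₂) X with hS | hL
    · have e1 : (if (2 ≤ m₂ ∧ Nat.Coprime m₂ q₁) ∧ (q₂ : ℝ) * m₂ ≤ X then W else 0) = W :=
        if_pos ⟨hP, hS⟩
      rw [e1]; linarith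
    · by_cases hpr : m₂.Prime
      · have hnd : ¬ m₂ ∣ q₁ := (Nat.Prime.coprime_iff_not_dvd hpr).1 hP.2
        rcases le_or_gt (4 * X * m₂) Y with hB | hWi
        · have e3 : (if X < (q₂ : ℝ) * m₂ ∧ m₂.Prime ∧ ¬ m₂ ∣ q₁ ∧ 4 * X * m₂ ≤ Y then W else 0) =
              W := if_pos ⟨hL, hpr, hnd, hB⟩
          rw [e3]; linarith
        · have e4 : (if (X < (q₂ : ℝ) * m₂ ∧ m₂.Prime ∧ Nat.Coprime m₂ q₁) ∧ Y < 4 * X * m₂ then W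
              else 0) = W := if_pos ⟨⟨hL, hpr, hP.2⟩, hWi⟩
          rw [e4]; linarith
      · have e2 : (if X < (q₂ : ℝ) * m₂ ∧ 2 ≤ m₂ ∧ ¬ m₂.Prime ∧ Nat.Coprime m₂ q₁ then W else 0) =
            W := if_pos ⟨hL, hP.1, hpr, hP.2⟩
        rw [e2]; linarith
  · rw [if_neg hP, norm_zero]
    linarith

/-- **R₁ FOUR-PIECE ASSEMBLY (termwise window) — `R1Rel c′` from hS, hLc (relative), hLpB (bulk,
zl-w16-p3's text) and hLpW (window, zl-closer-1 g2's text).** [cite: Zhang2022LandauSiegel, §17 u021 p.98] -/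
theorem step17_u021Chi_R1Rel_of_split4abs (c' : ℝ)
    (hS : ∀ ε : ℝ, 0 < ε → ForAllLarge fun D _ χ => AssumptionA D χ →
      (∑ l ∈ Finset.Ico 1 (D ^ 4), ‖nu χ l‖ / l *
          ∑ q ∈ l.divisorsAntidiagonal, ∑' m₁ : ℕ, ∑' m₂ : ℕ,
            if (2 ≤ m₂ ∧ Nat.Coprime m₂ q.1) ∧ (q.2 : ℝ) * m₂ ≤ (D : ℝ) ^ 4 then
              ‖bcoef D (q.1 * m₁)‖ * ‖nuOneStar c' χ (q.2 * m₂)‖ * ‖kappa2bar c' D (m₁ * m₂)‖ /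
                ((m₁ : ℝ) * m₂)
            else 0) ≤ ε * (frakA χ + 1))
    (hLc : ∀ ε : ℝ, 0 < ε → ForAllLarge fun D _ χ => AssumptionA D χ →
      (∑ l ∈ Finset.Ico 1 (D ^ 4), ‖nu χ l‖ / l *
          ∑ q ∈ l.divisorsAntidiagonal, ∑' m₁ : ℕ, ∑' m₂ : ℕ,
            if (D : ℝ) ^ 4 < (q.2 : ℝ) * m₂ ∧ 2 ≤ m₂ ∧ ¬ m₂.Prime ∧ Nat.Coprime m₂ q.1 then
              ‖bcoef D (q.1 * m₁)‖ * ‖nuOneStar c' χ (q.2 * m₂)‖ * ‖kappa2bar c' D (m₁ * m₂)‖ /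
                ((m₁ : ℝ) * m₂)
            else 0) ≤ ε * (frakA χ + 1))
    (hLpB : ∀ ε : ℝ, 0 < ε → ForAllLarge fun D _ χ => AssumptionA D χ →
      ∑ l ∈ Finset.Ico 1 (D ^ 4), ‖nu χ l‖ / l *
        ∑ q ∈ l.divisorsAntidiagonal, ∑' m₁ : ℕ, ∑' p : ℕ,
          (if (D : ℝ) ^ 4 < q.2 * p ∧ p.Prime ∧ ¬ p ∣ q.1 ∧ 4 * (D : ℝ) ^ 4 * p ≤ bigT D ^ 2 then
            ‖bcoef D (q.1 * m₁)‖ * ‖nuOneStar c' χ (q.2 * p)‖ * ‖kappa2bar c' D (m₁ * p)‖ /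
              ((m₁ : ℝ) * p) else 0) ≤ ε)
    (hLpW : ∀ ε : ℝ, 0 < ε → ForAllLarge fun D _ χ => AssumptionA D χ →
      (∑ l ∈ Finset.Ico 1 (D ^ 4), ‖nu χ l‖ / l *
          ∑ q ∈ l.divisorsAntidiagonal, ∑' m₁ : ℕ, ∑' m₂ : ℕ,
            if ((D : ℝ) ^ 4 < (q.2 : ℝ) * m₂ ∧ m₂.Prime ∧ Nat.Coprime m₂ q.1) ∧
                bigT D ^ 2 < 4 * (D : ℝ) ^ 4 * m₂ then
              ‖bcoef D (q.1 * m₁)‖ * ‖nuOneStar c' χ (q.2 * m₂)‖ * ‖kappa2bar c' D (m₁ * m₂)‖ /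
                ((m₁ : ℝ) * m₂)
            else 0) ≤ ε * (frakA χ + 1)) :
    ∀ ε : ℝ, 0 < ε → ForAllLarge fun D _ χ => AssumptionA D χ →
      ‖∑ l ∈ Finset.Ico 1 (D ^ 4), nu χ l / (l : ℂ) *
          ∑ q ∈ l.divisorsAntidiagonal, ∑' m₁ : ℕ, ∑' m₂ : ℕ,
            if 2 ≤ m₂ ∧ Nat.Coprime m₂ q.1 then
              bcoef D (q.1 * m₁) * χ ((q.1 * m₁ : ℕ) : ZMod D) * nuOneStar c' χ (q.2 * m₂) *
                kappa2bar c' D (m₁ * m₂) / ((m₁ : ℂ) * m₂)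
            else 0‖ ≤ ε * (frakA χ + 1) := by
  intro ε hε
  have hε4 : 0 < ε / 4 := by positivity
  obtain ⟨D₀, h⟩ := (((hS _ hε4).and (hLc _ hε4)).and (hLpB _ hε4)).and (hLpW _ hε4)
  refine ⟨D₀, fun D _ χ hD hq hp hA => ?_⟩
  obtain ⟨⟨⟨eS, eLc⟩, eLpB⟩, eLpW⟩ := h D χ hD hq hp
  replace eS := eS hA
  replace eLc := eLc hA
  replace eLpB := eLpB hA
  replace eLpW := eLpW hA
  have hA0 : 0 ≤ frakA χ := frakA_nonneg χ
  obtain ⟨N, hbN, hνN⟩ := exists_R1_support χ c'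
  set T : ℕ × ℕ → ℕ → ℕ → ℂ := fun q m₁ m₂ =>
    bcoef D (q.1 * m₁) * χ ((q.1 * m₁ : ℕ) : ZMod D) * nuOneStar c' χ (q.2 * m₂) *
      kappa2bar c' D (m₁ * m₂) / ((m₁ : ℂ) * m₂) with hT
  set W : ℕ × ℕ → ℕ → ℕ → ℝ := fun q m₁ m₂ =>
    ‖bcoef D (q.1 * m₁)‖ * ‖nuOneStar c' χ (q.2 * m₂)‖ * ‖kappa2bar c' D (m₁ * m₂)‖ /
      ((m₁ : ℝ) * m₂) with hW
  set F : ℕ × ℕ → ℕ → ℕ → ℂ := fun q m₁ m₂ =>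
    if 2 ≤ m₂ ∧ Nat.Coprime m₂ q.1 then T q m₁ m₂ else 0 with hF
  set FS : ℕ × ℕ → ℕ → ℕ → ℝ := fun q m₁ m₂ =>
    if (2 ≤ m₂ ∧ Nat.Coprime m₂ q.1) ∧ (q.2 : ℝ) * m₂ ≤ (D : ℝ) ^ 4 then W q m₁ m₂ else 0 with hFS
  set FLc : ℕ × ℕ → ℕ → ℕ → ℝ := fun q m₁ m₂ =>
    if (D : ℝ) ^ 4 < (q.2 : ℝ) * m₂ ∧ 2 ≤ m₂ ∧ ¬ m₂.Prime ∧ Nat.Coprime m₂ q.1 then W q m₁ m₂ else 0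
    with hFLc
  set FLpB : ℕ × ℕ → ℕ → ℕ → ℝ := fun q m₁ m₂ =>
    if (D : ℝ) ^ 4 < (q.2 : ℝ) * m₂ ∧ m₂.Prime ∧ ¬ m₂ ∣ q.1 ∧ 4 * (D : ℝ) ^ 4 * m₂ ≤ bigT D ^ 2 then
      W q m₁ m₂ else 0 with hFLpB
  set FLpW : ℕ × ℕ → ℕ → ℕ → ℝ := fun q m₁ m₂ =>
    if ((D : ℝ) ^ 4 < (q.2 : ℝ) * m₂ ∧ m₂.Prime ∧ Nat.Coprime m₂ q.1) ∧
        bigT D ^ 2 < 4 * (D : ℝ) ^ 4 * m₂ then W q m₁ m₂ else 0 with hFLpW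
  have hq1 : ∀ {l : ℕ} {q : ℕ × ℕ}, q ∈ l.divisorsAntidiagonal → 1 ≤ q.1 ∧ 1 ≤ q.2 := by
    intro l q hq
    have h' := Nat.mem_divisorsAntidiagonal.1 hq
    refine ⟨Nat.pos_of_ne_zero fun h0 => h'.2 ?_, Nat.pos_of_ne_zero fun h0 => h'.2 ?_⟩
    · rw [← h'.1, h0, zero_mul]
    · rw [← h'.1, h0, mul_zero]
  have hW0 : ∀ q m₁ m₂, 0 ≤ W q m₁ m₂ := fun q m₁ m₂ => by simp only [hW]; positivity
  have hWvan₁ : ∀ q : ℕ × ℕ, 1 ≤ q.1 → ∀ m₁ m₂, N ≤ m₁ → W q m₁ m₂ = 0 := by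
    intro q hq m₁ m₂ hm; simp only [hW]; rw [hbN q.1 m₁ hq hm]; simp
  have hWvan₂ : ∀ q : ℕ × ℕ, 1 ≤ q.2 → ∀ m₁ m₂, N ≤ m₂ → W q m₁ m₂ = 0 := by
    intro q hq m₁ m₂ hm; simp only [hW]; rw [hνN q.2 m₂ hq hm]; simp
  have hTvan₁ : ∀ q : ℕ × ℕ, 1 ≤ q.1 → ∀ m₁ m₂, N ≤ m₁ → T q m₁ m₂ = 0 := by
    intro q hq m₁ m₂ hm; simp only [hT]; rw [hbN q.1 m₁ hq hm]; simp
  have hTvan₂ : ∀ q : ℕ × ℕ, 1 ≤ q.2 → ∀ m₁ m₂, N ≤ m₂ → T q m₁ m₂ = 0 := by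
    intro q hq m₁ m₂ hm; simp only [hT]; rw [hνN q.2 m₂ hq hm]; simp
  have hF_eq : ∀ {l : ℕ} {q : ℕ × ℕ}, q ∈ l.divisorsAntidiagonal →
      (∑' m₁ : ℕ, ∑' m₂ : ℕ, F q m₁ m₂) = ∑ m₁ ∈ range N, ∑ m₂ ∈ range N, F q m₁ m₂ := by
    intro l q hq
    obtain ⟨h1, h2⟩ := hq1 hq
    refine tsum_tsum_eq_sum_sum_of_vanish₅ (F q) N (fun m₁ m₂ hm => ?_) (fun m₁ m₂ hm => ?_)
    · simp only [hF]; rw [hTvan₁ q h1 m₁ m₂ hm]; simp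
    · simp only [hF]; rw [hTvan₂ q h2 m₁ m₂ hm]; simp
  have hG_eq : ∀ (G' : ℕ × ℕ → ℕ → ℕ → ℝ), (∀ q m₁ m₂, G' q m₁ m₂ = 0 ∨ G' q m₁ m₂ = W q m₁ m₂) →
      ∀ {l : ℕ} {q : ℕ × ℕ}, q ∈ l.divisorsAntidiagonal →
        (∑' m₁ : ℕ, ∑' m₂ : ℕ, G' q m₁ m₂) = ∑ m₁ ∈ range N, ∑ m₂ ∈ range N, G' q m₁ m₂ := by
    intro G' hG' l q hq
    obtain ⟨h1, h2⟩ := hq1 hq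
    refine tsum_tsum_eq_sum_sum_of_vanish₅ (G' q) N (fun m₁ m₂ hm => ?_) (fun m₁ m₂ hm => ?_)
    · rcases hG' q m₁ m₂ with h | h
      · exact h
      · rw [h, hWvan₁ q h1 m₁ m₂ hm]
    · rcases hG' q m₁ m₂ with h | h
      · exact h
      · rw [h, hWvan₂ q h2 m₁ m₂ hm]
  have hFS_cases : ∀ q m₁ m₂, FS q m₁ m₂ = 0 ∨ FS q m₁ m₂ = W q m₁ m₂ := by
    intro q m₁ m₂; simp only [hFS]; split_ifs <;> simp
  have hFLc_cases : ∀ q m₁ m₂, FLc q m₁ m₂ = 0 ∨ FLc q m₁ m₂ = W q m₁ m₂ := by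
    intro q m₁ m₂; simp only [hFLc]; split_ifs <;> simp
  have hFLpB_cases : ∀ q m₁ m₂, FLpB q m₁ m₂ = 0 ∨ FLpB q m₁ m₂ = W q m₁ m₂ := by
    intro q m₁ m₂; simp only [hFLpB]; split_ifs <;> simp
  have hFLpW_cases : ∀ q m₁ m₂, FLpW q m₁ m₂ = 0 ∨ FLpW q m₁ m₂ = W q m₁ m₂ := by
    intro q m₁ m₂; simp only [hFLpW]; split_ifs <;> simp
  have hpt : ∀ q m₁ m₂, ‖F q m₁ m₂‖ ≤
      FS q m₁ m₂ + FLc q m₁ m₂ + FLpB q m₁ m₂ + FLpW q m₁ m₂ := by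
    intro q m₁ m₂
    simp only [hF, hFS, hFLc, hFLpB, hFLpW]
    exact norm_R1_summand_le_split4abs (hW0 q m₁ m₂) (norm_R1_term_le χ c' q.1 q.2 m₁ m₂)
      q.1 q.2 m₂
  have hlq : ∀ {l : ℕ} {q : ℕ × ℕ}, q ∈ l.divisorsAntidiagonal →
      ‖∑' m₁ : ℕ, ∑' m₂ : ℕ, F q m₁ m₂‖ ≤
        (∑' m₁ : ℕ, ∑' m₂ : ℕ, FS q m₁ m₂) + (∑' m₁ : ℕ, ∑' m₂ : ℕ, FLc q m₁ m₂) +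
          (∑' m₁ : ℕ, ∑' m₂ : ℕ, FLpB q m₁ m₂) + (∑' m₁ : ℕ, ∑' m₂ : ℕ, FLpW q m₁ m₂) := by
    intro l q hq
    rw [hF_eq hq, hG_eq FS hFS_cases hq, hG_eq FLc hFLc_cases hq, hG_eq FLpB hFLpB_cases hq,
      hG_eq FLpW hFLpW_cases hq, ← Finset.sum_add_distrib, ← Finset.sum_add_distrib,
      ← Finset.sum_add_distrib]
    refine (norm_sum_le _ _).trans (Finset.sum_le_sum fun m₁ _ => ?_)
    rw [← Finset.sum_add_distrib, ← Finset.sum_add_distrib, ← Finset.sum_add_distrib]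
    exact (norm_sum_le _ _).trans (Finset.sum_le_sum fun m₂ _ => hpt q m₁ m₂)
  have hl : ∀ l ∈ Finset.Ico 1 (D ^ 4),
      ‖nu χ l / (l : ℂ) * ∑ q ∈ l.divisorsAntidiagonal, ∑' m₁ : ℕ, ∑' m₂ : ℕ, F q m₁ m₂‖ ≤
        ‖nu χ l‖ / l * ∑ q ∈ l.divisorsAntidiagonal, (∑' m₁ : ℕ, ∑' m₂ : ℕ, FS q m₁ m₂) +
        ‖nu χ l‖ / l * ∑ q ∈ l.divisorsAntidiagonal, (∑' m₁ : ℕ, ∑' m₂ : ℕ, FLc q m₁ m₂) +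
        ‖nu χ l‖ / l * ∑ q ∈ l.divisorsAntidiagonal, (∑' m₁ : ℕ, ∑' m₂ : ℕ, FLpB q m₁ m₂) +
        ‖nu χ l‖ / l * ∑ q ∈ l.divisorsAntidiagonal, (∑' m₁ : ℕ, ∑' m₂ : ℕ, FLpW q m₁ m₂) := by
    intro l hl
    rw [norm_mul, norm_div, Complex.norm_natCast, ← mul_add, ← mul_add, ← mul_add,
      ← Finset.sum_add_distrib, ← Finset.sum_add_distrib, ← Finset.sum_add_distrib]
    refine mul_le_mul_of_nonneg_left ((norm_sum_le _ _).trans (Finset.sum_le_sum fun q hq => hlq hq))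
      (by positivity)
  calc ‖∑ l ∈ Finset.Ico 1 (D ^ 4), nu χ l / (l : ℂ) *
          ∑ q ∈ l.divisorsAntidiagonal, ∑' m₁ : ℕ, ∑' m₂ : ℕ, F q m₁ m₂‖
      ≤ ∑ l ∈ Finset.Ico 1 (D ^ 4), ‖nu χ l / (l : ℂ) *
          ∑ q ∈ l.divisorsAntidiagonal, ∑' m₁ : ℕ, ∑' m₂ : ℕ, F q m₁ m₂‖ := norm_sum_le _ _
    _ ≤ ∑ l ∈ Finset.Ico 1 (D ^ 4),
          (‖nu χ l‖ / l * ∑ q ∈ l.divisorsAntidiagonal, (∑' m₁ : ℕ, ∑' m₂ : ℕ, FS q m₁ m₂) +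
          ‖nu χ l‖ / l * ∑ q ∈ l.divisorsAntidiagonal, (∑' m₁ : ℕ, ∑' m₂ : ℕ, FLc q m₁ m₂) +
          ‖nu χ l‖ / l * ∑ q ∈ l.divisorsAntidiagonal, (∑' m₁ : ℕ, ∑' m₂ : ℕ, FLpB q m₁ m₂) +
          ‖nu χ l‖ / l * ∑ q ∈ l.divisorsAntidiagonal, (∑' m₁ : ℕ, ∑' m₂ : ℕ, FLpW q m₁ m₂)) :=
        Finset.sum_le_sum hl
    _ = (∑ l ∈ Finset.Ico 1 (D ^ 4), ‖nu χ l‖ / l *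
            ∑ q ∈ l.divisorsAntidiagonal, (∑' m₁ : ℕ, ∑' m₂ : ℕ, FS q m₁ m₂)) +
        (∑ l ∈ Finset.Ico 1 (D ^ 4), ‖nu χ l‖ / l *
            ∑ q ∈ l.divisorsAntidiagonal, (∑' m₁ : ℕ, ∑' m₂ : ℕ, FLc q m₁ m₂)) +
        (∑ l ∈ Finset.Ico 1 (D ^ 4), ‖nu χ l‖ / l *
            ∑ q ∈ l.divisorsAntidiagonal, (∑' m₁ : ℕ, ∑' m₂ : ℕ, FLpB q m₁ m₂)) +
        (∑ l ∈ Finset.Ico 1 (D ^ 4), ‖nu χ l‖ / l *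
            ∑ q ∈ l.divisorsAntidiagonal, (∑' m₁ : ℕ, ∑' m₂ : ℕ, FLpW q m₁ m₂)) := by
        rw [Finset.sum_add_distrib, Finset.sum_add_distrib, Finset.sum_add_distrib]
    _ ≤ ε / 4 * (frakA χ + 1) + ε / 4 * (frakA χ + 1) + ε / 4 + ε / 4 * (frakA χ + 1) :=
        add_le_add (add_le_add (add_le_add eS eLc) eLpB) eLpW
    _ ≤ ε * (frakA χ + 1) := by nlinarith

end Literature.NumberTheory.LFunctions.Zhang2022.Phi3Eval
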